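import Literature.AnabelianGeometry.AbsoluteAnabelian.AbsTopIChains
import Literature.AnabelianGeometry.AbsoluteAnabelian.AbsTopII.BelyiCuspidalization
import HarnessLib

/-!
# [AbsTopII] §3: the `Π`-chains of Corollaries 3.3 (i), (iii)(a) and 3.7 (a) over [AbsTopI] Def 4.2

S. Mochizuki, *Topics in Absolute Anabelian Geometry II: Decomposition Groups and Endomorphisms*
[AbsTopII], §3 pp. 66–73 (manuscript pagination, lit key `paper:url-585b8d0ad0d9`; bib key
`MochizukiAbsTopII2013`).  Companion of abc-iut-L4-t6's landed §3 files (`EllipticCuspidalization`,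
`BelyiCuspidalization`), which record the `Π`-chains of Cor 3.3 (iii)(a) / Cor 3.7 (a) only through
their TYPE-CHAINS (`ElementaryOp`, `Ex_3_2_ii_typeChain`, `Ex_3_6_ii_typeChain`) because abc-iut-L4-t4's
`Π`-chains ([AbsTopI] Def 4.2 (iii)–(v): `ElemOpType`, `ChainGroup`, `PiChain`, `HasTerminalIso`,
`IsEtLocObj`; `AbsTopIChains.lean`) were not yet in the tree.  They are now (p406295), and this file
supplies the REAL chain-theoretic vocabulary the `𝒟`-parametrised statements of Cor 3.3 / 3.4 / 3.7 /
3.8 (`AbsTopII/CuspidalizationComparison.lean`, `AbsTopII/EllipticCuspidalizationComparison.lean`) use: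

* `ElementaryOp.toElemOpType`: the §3 sub-alphabet `{⋏, ⋎, •}` inside `{⋏, ⋎, •, ⊚}` (the dedup
  embedding of finding F7, `plan/L4/LC1-CHAIN.md`; `ElementaryOp` was first-filed);
* `trivialChain`: "the trivial `Π`-chain [of length `0`]" (Cor 3.3 (iii)(a) p. 68, Cor 3.7 (a) p. 73);
* `HasTerminalChainOfType C hP hΔ hne τ P`: "there exists a `Π`-chain [...] with associated type-chain
  `τ` that admits a terminal isomorphism with the trivial `Π`-chain", whose second-to-last group is the
  given `Π_V = P` (Cor 3.3: "whose final three groups consist of `Π_D ⇝ Π_V ⇝ Π`"; Cor 3.7: "the chain of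
  •'s terminating at the second to last group"), PROVED satisfiable (`hasTerminalChainOfType_quot_top`);
* `LastTermsIsomorphic`: isomorphy in `Chain(Π)` ([AbsTopI] Def 4.2 (iv)) of chains of length `1`,
  spelled out on the last terms (= abc-iut-L4-t13's `PiChainIsoOver (Iso.refl _)` for such chains,
  `AbsTopI/SemiAbsoluteChains.lean`, pending — TODO-import);
* `IsEtLocTerminal`: "forms a terminal object of `ÉtLoc(Π)`" (Cor 3.3 (i) p. 68) — READING: the
  morphisms of `ÉtLoc(Π) := Chain^{iso-trm}(Π){⋏, ⋎}` are terminal ISOmorphisms ([AbsTopI] Def 4.2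
  (iv)(v) pp. 50–51), for which a terminal object would force all objects of `ÉtLoc(Π)` (e.g. `Π`
  itself and `Π ⇝ Π_C`) to be isomorphic; the notion meant is the one Def 3.1 (a) quotes, [Mzk6]
  Rmk 2.1.1 ("`k`-core" = terminal object of `Loc_k(X)`, morphisms = finite étale `k`-morphisms),
  i.e. terminality with respect to INJECTIVE terminal homomorphisms, unique up to inner automorphisms
  of the target; typed so and flagged -- TODO(reading);
* `EllipticCuspidalization.toCuspidalization`: the output `Π_{U_X} ↠ Π` of Cor 3.3 in the common
  `Cuspidalization` format of `BelyiCuspidalization.lean`.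

HONEST FRAMING: typed ≠ discharged; nothing here takes a side on [IUTchIII] Cor 3.12.
-/

noncomputable section

open CategoryTheory Topology
open scoped Pointwise

universe u

namespace Literature.AnabelianGeometry.AbsoluteAnabelian.AbsTopII

open Literature.AlgebraicGeometry.Frobenioids (IsSlimGroup)
open FundamentalExtension

/-! ### The §3 type-chains as type-chains of [AbsTopI] Def 4.2 -/

/-- The §3 sub-alphabet `{⋏, ⋎, •}` (`ElementaryOp`, first filed in
`EllipticCuspidalization.lean`) inside the full alphabet `{⋏, ⋎, •, ⊚}` of [AbsTopI] Def 4.2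
(abc-iut-L4-t4's `ElemOpType`): the embedding announced there as TODO-import.
[cite: MochizukiAbsTopII2013, Ex 3.2 (i) p.66] -/
def ElementaryOp.toElemOpType : ElementaryOp → ElemOpType
  | .cov => .finEtCov
  | .quot => .finEtQuot
  | .decusp => .deCusp

/-- The embedding of alphabets is injective. [cite: MochizukiAbsTopII2013, Ex 3.2 (i) p.66] -/
theorem ElementaryOp.toElemOpType_injective : Function.Injective ElementaryOp.toElemOpType := by
  intro a b h
  cases a <;> cases b <;> first | rfl | simp [ElementaryOp.toElemOpType] at h

/-- De-orbification `⊚` does not occur in the chains of §3 (Ex 3.2 / Ex 3.6 use `⋏, ⋎, •` only).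
[cite: MochizukiAbsTopII2013, Ex 3.6 (ii) p.72] -/
theorem ElementaryOp.toElemOpType_ne_deOrb (o : ElementaryOp) :
    o.toElemOpType ≠ ElemOpType.deOrb := by
  cases o <;> simp [ElementaryOp.toElemOpType]

/-- A §3 type-chain, read in [AbsTopI]'s alphabet, only contains the symbols `⋏, ⋎, •`.
[cite: MochizukiAbsTopII2013, Ex 3.6 (ii) p.72] -/
theorem mem_of_mem_map_toElemOpType {τ : List ElementaryOp} {t : ElemOpType}
    (h : t ∈ τ.map ElementaryOp.toElemOpType) :
    t ∈ ({.finEtCov, .finEtQuot, .deCusp} : Set ElemOpType) := by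
  obtain ⟨o, -, rfl⟩ := List.mem_map.mp h
  cases o <;> simp [ElementaryOp.toElemOpType]

/-! ### The trivial `Π`-chain; chains of given type with a terminal isomorphism to it -/

section Chains

variable {E : FundamentalExtension.{u}} (C : CuspidalData E) (hP : IsSlimGroup E.arith)
  (hΔ : IsSlimGroup E.geom) (hne : E.geom ≠ ⊥)

/-- "The trivial `Π`-chain [of length `0`]" (Cor 3.3 (iii)(a) p. 68, Cor 3.7 (a) p. 73; [AbsTopI]
Def 4.2 (iii) (0_Π): `Π₀ = Π`), as a `PiChain` of abc-iut-L4-t4.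
[cite: MochizukiAbsTopII2013, Cor 3.7 (a) p.73] -/
def trivialChain : E.PiChain C hP hΔ hne where
  len := 0
  term := fun _ => ChainGroup.self hP hΔ hne
  term_zero := rfl
  types := fun j => j.elim0
  isElemOp := fun j => j.elim0

/-- The trivial chain has the empty type-chain. [cite: MochizukiAbsTopII2013, Cor 3.7 (a) p.73] -/
theorem typeChain_trivialChain : (trivialChain C hP hΔ hne).typeChain = [] := rfl

/-- The trivial chain admits a terminal isomorphism with itself (the identity of `Π`).
[cite: MochizukiAbsTopII2013, Cor 3.7 (a) p.73] -/
theorem hasTerminalIso_trivialChain :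
    (trivialChain C hP hΔ hne).HasTerminalIso (trivialChain C hP hΔ hne) :=
  ⟨ContinuousMulEquiv.refl _, 1, fun x => by simp⟩

/-- The CHAIN CLAUSE of Cor 3.3 (iii)(a) p. 68 / Cor 3.7 (a) p. 73, for REAL over abc-iut-L4-t4's
`Π`-chains ([AbsTopI] Def 4.2 (iii)–(iv)): "there exists a [not necessarily unique] `Π`-chain [...]
with associated type-chain `τ` [...] that admits a terminal isomorphism with the trivial `Π`-chain
[of length `0`]", whose SECOND-TO-LAST group is `Π_V` ("whose final [...] groups consist of [...]
`Π_V ⇝ Π`", Cor 3.3; "`Π_U ↠ Π_V` may be recovered from the chain of •'s terminating at the second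
to last group", Cor 3.7): the term of index `len − 1` is isomorphic to the given `P = Π_V ⊆ Π`
compatibly, up to an inner automorphism of `G`, with the projections to `G`.  Relative to cuspidal
data `C` on `Π` (the • steps, Def 4.2 (iii) (3_Π)) and the slimness inputs of `PiChain`.
[cite: MochizukiAbsTopII2013, Cor 3.7 (a) p.73] -/
def HasTerminalChainOfType (τ : List ElementaryOp) (P : Subgroup E.arith) : Prop :=
  ∃ c : E.PiChain C hP hΔ hne,
    c.typeChain = τ.map ElementaryOp.toElemOpType ∧
      c.HasTerminalIso (trivialChain C hP hΔ hne) ∧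
      ∃ (j : Fin (c.len + 1)) (_ : j.val + 1 = c.len) (e : ↥P ≃ₜ* (c.term j).grp) (g : E.gal),
        ∀ x : P, (c.term j).proj (e x) = MulAut.conj g (E.aug x)

variable {C hP hΔ hne}

/-- A chain witnessing `HasTerminalChainOfType C … τ P` lies in the full subcategory of chains with
symbols among `{⋏, ⋎, •}` ([AbsTopI] Def 4.2 (v)). [cite: MochizukiAbsTopII2013, Cor 3.7 (a) p.73] -/
theorem HasTerminalChainOfType.typesAmong {τ : List ElementaryOp} {P : Subgroup E.arith}
    (h : HasTerminalChainOfType C hP hΔ hne τ P) :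
    ∃ c : E.PiChain C hP hΔ hne, c.typeChain = τ.map ElementaryOp.toElemOpType ∧
      c.TypesAmong {.finEtCov, .finEtQuot, .deCusp} := by
  obtain ⟨c, hc, -, -⟩ := h
  refine ⟨c, hc, fun j => ?_⟩
  apply mem_of_mem_map_toElemOpType (τ := τ)
  rw [← hc, PiChain.typeChain, List.mem_ofFn]
  exact ⟨j, rfl⟩

/-- The whole group `Π` as the open subgroup `⊤`, bi-continuously.
[cite: MochizukiAbsTopII2013, Cor 3.7 (a) p.73] -/
def topContinuousMulEquiv (E : FundamentalExtension.{u}) : ↥(⊤ : Subgroup E.arith) ≃ₜ* E.arith :=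
  { Subgroup.topEquiv with
    continuous_toFun := continuous_subtype_val
    continuous_invFun := by
      apply Continuous.subtype_mk
      exact continuous_id }

/-- The identity of `Π` as an elementary operation of type `⋎` from `Π₀ = Π` to itself (an open
immersion compatible with the rigidifying homomorphisms, [AbsTopI] Def 4.2 (iii)(b)).
[cite: MochizukiAbsTopII2013, Cor 3.3 (i) p.68] -/
theorem isElemOp_finEtQuot_self :
    ChainGroup.IsElemOp C .finEtQuot (ChainGroup.self hP hΔ hne) (ChainGroup.self hP hΔ hne) := by
  refine ⟨ContinuousMonoidHom.id _, fun _ _ h => h, ?_, ⊤, isOpen_univ, le_rfl, le_rfl, fun _ => rfl⟩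
  rw [show Set.range (ContinuousMonoidHom.id ((ChainGroup.self hP hΔ hne : E.ChainGroup).grp)) =
      Set.univ from Set.range_eq_univ.mpr fun x => ⟨x, rfl⟩]
  exact isOpen_univ

/-- SATISFIABILITY of the chain clause (sanity, PROVED): the chain `Π ⇝ Π` of length `1` and type `⋎`
(the identity quotient) has type-chain `⋎`, admits a terminal isomorphism with the trivial chain (the
identity), and its second-to-last group `Π₀ = Π` is `⊤ ⊆ Π` — so `HasTerminalChainOfType` is not an
unsatisfiable predicate. [cite: MochizukiAbsTopII2013, Cor 3.3 (i) p.68] -/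
theorem hasTerminalChainOfType_quot_top :
    HasTerminalChainOfType C hP hΔ hne [ElementaryOp.quot] ⊤ := by
  let c : E.PiChain C hP hΔ hne :=
    { len := 1
      term := fun _ => ChainGroup.self hP hΔ hne
      term_zero := rfl
      types := fun _ => .finEtQuot
      isElemOp := fun _ => isElemOp_finEtQuot_self }
  refine ⟨c, rfl, ⟨ContinuousMulEquiv.refl _, 1, fun x => ?_⟩, 0, rfl, topContinuousMulEquiv E,
    1, fun x => ?_⟩
  · simp only [map_one, MulAut.one_apply]
    rfl
  · simp only [map_one, MulAut.one_apply]
    rfl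

/-- Isomorphy in `Chain(Π)` ([AbsTopI] Def 4.2 (iv): "isomorphisms of profinite groups `Πⱼ ⥲ Ψⱼ`
compatible with the rigidifying homomorphisms") for chains of length `1`, spelled out on the last
terms: an isomorphism over `G` agreeing with the rigidifying homomorphisms on a common open subgroup
of `Π` (the terms of index `0` are both `Π`).  (= abc-iut-L4-t13's `PiChainIsoOver (Iso.refl E)`
restricted to length `1`; TODO-import.) [cite: MochizukiAbsTopII2013, Cor 3.3 (i) p.68] -/
def LastTermsIsomorphic (c c' : E.PiChain C hP hΔ hne) : Prop :=
  ∃ f : c.last.grp ≃ₜ* c'.last.grp, (∀ y, c'.last.proj (f y) = c.last.proj y) ∧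
    ∃ U : Subgroup E.arith, IsOpen (U : Set E.arith) ∧ ∃ (h : U ≤ c.last.dom) (h' : U ≤ c'.last.dom),
      ∀ x : U, f (c.last.rig ⟨x, h x.2⟩) = c'.last.rig ⟨x, h' x.2⟩

/-- `LastTermsIsomorphic` is reflexive. [cite: MochizukiAbsTopII2013, Cor 3.3 (i) p.68] -/
theorem LastTermsIsomorphic.refl (c : E.PiChain C hP hΔ hne) : LastTermsIsomorphic c c :=
  ⟨ContinuousMulEquiv.refl _, fun _ => rfl, c.last.dom, c.last.isOpen_dom, le_rfl, le_rfl,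
    fun _ => rfl⟩

/-- "forms a terminal object of `ÉtLoc(Π)`" (Cor 3.3 (i) p. 68) in the READING explained in the
module docstring ([Mzk6] Rmk 2.1.1: a `k`-core is a terminal object for finite étale `k`-morphisms):
every object `c'` of `ÉtLoc(Π)` (a chain of `⋏`'s and `⋎`'s, abc-iut-L4-t4's `IsEtLocObj`) admits an
INJECTIVE terminal homomorphism to `c` — an open injection of last groups compatible with the maps to
`G` up to an inner automorphism of `G` — unique up to an inner automorphism of the target.
-- TODO(reading). [cite: MochizukiAbsTopII2013, Cor 3.3 (i) p.68] -/
def IsEtLocTerminal (c : E.PiChain C hP hΔ hne) : Prop :=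
  ∀ c' : E.PiChain C hP hΔ hne, c'.IsEtLocObj →
    (∃ (φ : c'.last.grp →ₜ* c.last.grp) (g : E.gal), Function.Injective φ ∧ IsOpen (Set.range φ) ∧
        ∀ x, c.last.proj (φ x) = MulAut.conj g (c'.last.proj x)) ∧
      ∀ (φ φ' : c'.last.grp →ₜ* c.last.grp) (g g' : E.gal),
        Function.Injective φ → IsOpen (Set.range φ) →
        (∀ x, c.last.proj (φ x) = MulAut.conj g (c'.last.proj x)) →
        Function.Injective φ' → IsOpen (Set.range φ') →
        (∀ x, c.last.proj (φ' x) = MulAut.conj g' (c'.last.proj x)) →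
          ∃ t : c.last.grp, ∀ x, φ' x = t * φ x * t⁻¹

end Chains

/-! ### The output of Cor 3.3 as a cuspidalization -/

/-- The output `Π_{U_X} ↠ Π` of an `EllipticCuspidalization` (Cor 3.3 (iii)) as a `Cuspidalization`
(the common format of §3 outputs used for Cor 3.7 / 3.8 in `BelyiCuspidalization.lean`).
[cite: MochizukiAbsTopII2013, Cor 3.3 (iii) p.68] -/
def EllipticCuspidalization.toCuspidalization {E : FundamentalExtension.{u}}
    (K : EllipticCuspidalization E) : Cuspidalization E :=
  ⟨K.cuspUX, K.proj, K.proj_arith_surjective, K.proj_gal_bijective⟩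

/-- The output cuspidalization is isomorphic over `Π` to itself.
[cite: MochizukiAbsTopII2013, Cor 3.3 (iii) p.68] -/
theorem EllipticCuspidalization.toCuspidalization_isoOver_self {E : FundamentalExtension.{u}}
    (K : EllipticCuspidalization E) : K.toCuspidalization.IsoOver K.toCuspidalization :=
  Cuspidalization.IsoOver.refl _

end Literature.AnabelianGeometry.AbsoluteAnabelian.AbsTopII
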